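import Mathlib.Algebra.MonoidAlgebra.Basic
import Mathlib.Algebra.MvPolynomial.Basic
import Mathlib.Algebra.Polynomial.Laurent
import Mathlib.Algebra.Polynomial.Lifts
import Mathlib.RingTheory.FinitePresentation
import Mathlib.RingTheory.IntegralClosure.IntegrallyClosed
import Mathlib.RingTheory.Localization.FractionRing
import Mathlib.RingTheory.Polynomial.RationalRoot
import Mathlib.RingTheory.Polynomial.UniqueFactorization
import Mathlib.Data.Rat.Lemmas
import Mathlib.Tactic.FieldSimp
import HarnessLib

/-!
# The group algebra `k[ℚ]`: level subalgebras `k[(1/d)ℤ]`, the finite-presentation obstruction, normality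

Topic: `Literature/AlgebraicGeometry/Resolution` (commutative algebra used by the refutation of
the tree's rendering `Temkin2013_Lemma332` of Temkin 2013, Lemma 3.3.2,
`InseparableLocalUniformizationDecompletionRefutation.lean`). Everything here is elementary and
PROVED; there are no named facts.

For a field `k`, the group algebra `k[ℚ] = AddMonoidAlgebra k ℚ` of the additive group of
rational numbers is the directed union of its *level subalgebras*
`B_d = k[(1/d)ℤ] ≅ k[t, t⁻¹]` (`d ≥ 1`), and `k[ℚ]` is free over each `B_d` on the monomials
`t^q`, `0 ≤ q < 1/d`. We record the two pieces of this structure that are needed: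

* `levelSubalgebra k d` (`B_d`, the range of `k[ℤ] → k[ℚ]` induced by `ι_d : z ↦ z/d`),
  `mem_levelSubalgebra_iff` (support in `(1/d)ℤ`), `exists_forall_mem_levelSubalgebra` (any finite
  set lies in some `B_d`);
* `proj k d : k[ℚ] → k[ℚ]`, the projection onto `B_d` killing the monomials with exponent outside
  `(1/d)ℤ`; it is `B_d`-linear (`proj_mul_of_mem`); and the `B_d`-linear functional
  `ell k d = proj_d (t^{-1/(2d)} · –)`, which VANISHES on `B_d` (`ell_of_mem`) and takes the value
  `1` on `t^{1/(2d)}` (`ell_single_half`).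

Main result, the **tower obstruction** `subsingleton_of_finitePresentation_of_finiteType`:
a finitely presented `k[ℚ]`-algebra `E` which is of finite type over `k` (compatibly) is the
zero ring. Proof: choose a presentation `E = k[ℚ][X₁, …, X_n]/(s₁, …, s_m)` and preimages `q_t`
of finitely many `k`-algebra generators `t` of `E`; all coefficients involved lie in one `B_d`.
The polynomials with coefficients in `B_d` then map ONTO `E` (their image is a `k`-subalgebra
containing the generators), so `t^{1/(2d)} · 1_E = f(q)` for such a `q`, i.e.
`C(t^{1/(2d)}) - q ∈ (s₁, …, s_m)`. Apply `ℓ_d` coefficientwise (`coeffwise`): this operator is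
linear over polynomials with coefficients in `B_d` (`coeffwise_mul_of_coeffs_mem`), hence maps
the ideal `(s₁, …, s_m)` into itself, kills `q`, and sends `C(t^{1/(2d)})` to `1`. So `1` is a
relation and `E = 0`. (Geometrically: `E` descends to a finitely presented `B_d`-algebra `E_d`
with `E = E_d ⊗_{B_d} k[ℚ] = ⊕_{0 ≤ q < 1/d} t^q E_d`, and finite generation over `k` forces
`E_d ⊗ 1` to exhaust `E`.) This is the algebraic heart of the counterexample to
`Temkin2013_Lemma332`: an affine model whose generic fibre is `k[ℚ]` (not of finite type over
`k`) admits no point smooth-equivalent over `k°` to the closed point of `Spec k°`.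

Finally `isIntegrallyClosed_rat`: **`k[ℚ]` is integrally closed** — each `B_d ≅ k[ℤ]` is a
localization of `k[X]`, hence integrally closed (`isIntegrallyClosed_levelSubalgebra`), and an
element of `Frac k[ℚ]` integral over `k[ℚ]` is a quotient of elements of some `B_d` satisfying a
monic equation over `B_d`.

## Sources

Standard commutative algebra (group algebras of torsion-free abelian groups as directed unions of
Laurent polynomial rings; descent of finitely presented algebras along directed unions,
EGA IV₃ 8.8.2); no single source — all declarations are `[folklore]`.
-/

noncomputable section

open AddMonoidAlgebra

namespace Literature.AlgebraicGeometry.Resolution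

namespace RatGroupAlgebra

variable {k : Type*} [Field k]

/-! ### The embeddings `ι_d : ℤ → ℚ`, `z ↦ z / d` -/

/-- `ι_d : ℤ → ℚ`, `z ↦ z / d`, as an additive monoid hom; its range is the subgroup `(1/d)ℤ`.
[folklore] -/
def iota (d : ℕ) : ℤ →+ ℚ where
  toFun z := (z : ℚ) / d
  map_zero' := by simp
  map_add' x y := by push_cast; ring

/-- `ι_d z = z / d`. [folklore] -/
theorem iota_apply (d : ℕ) (z : ℤ) : iota d z = (z : ℚ) / d := rfl

/-- `ι_d` is injective for `d ≠ 0`. [folklore] -/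
theorem iota_injective {d : ℕ} (hd : d ≠ 0) : Function.Injective (iota d) := by
  intro x y h
  simp only [iota_apply] at h
  have hd' : (d : ℚ) ≠ 0 := by exact_mod_cast hd
  exact_mod_cast (div_left_inj' hd').mp h

/-- `q ∈ (1/d)ℤ ↔ q·d ∈ ℤ`. [folklore] -/
theorem mem_range_iota_iff {d : ℕ} (hd : d ≠ 0) (q : ℚ) :
    q ∈ (iota d).range ↔ ∃ z : ℤ, (z : ℚ) = q * d := by
  have hd' : (d : ℚ) ≠ 0 := by exact_mod_cast hd
  constructor
  · rintro ⟨z, rfl⟩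
    exact ⟨z, by rw [iota_apply, div_mul_cancel₀ _ hd']⟩
  · rintro ⟨z, hz⟩
    exact ⟨z, by rw [iota_apply, hz, mul_div_cancel_right₀ _ hd']⟩

/-- A rational lies in `(1/d)ℤ` whenever its denominator divides `d`. [folklore] -/
theorem mem_range_iota_of_den_dvd {d : ℕ} (hd : d ≠ 0) (q : ℚ) (h : q.den ∣ d) :
    q ∈ (iota d).range := by
  rw [mem_range_iota_iff hd]
  obtain ⟨e, he⟩ := h
  refine ⟨q.num * e, ?_⟩
  rw [he]
  push_cast
  rw [← mul_assoc, Rat.mul_den_eq_num]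

/-- `1/(2d) ∉ (1/d)ℤ`. [folklore] -/
theorem half_not_mem_range_iota {d : ℕ} (hd : d ≠ 0) :
    (1 / (2 * d) : ℚ) ∉ (iota d).range := by
  rw [mem_range_iota_iff hd]
  rintro ⟨z, hz⟩
  have hd' : (d : ℚ) ≠ 0 := by exact_mod_cast hd
  have : (z : ℚ) = 1 / 2 := by
    rw [hz]; field_simp
  have h2 : (2 * z : ℚ) = 1 := by rw [this]; norm_num
  have h3 : (2 * z : ℤ) = 1 := by exact_mod_cast h2
  omega

/-! ### The level subalgebras `B_d = k[(1/d)ℤ]` -/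

variable (k) in
/-- The **level subalgebra** `B_d = k[(1/d)ℤ] ⊆ k[ℚ]`: the range of the `k`-algebra map
`k[ℤ] → k[ℚ]` induced by `ι_d` (for `d ≠ 0` an isomorphic copy of the Laurent polynomial ring).
[folklore] -/
def levelSubalgebra (d : ℕ) : Subalgebra k (AddMonoidAlgebra k ℚ) :=
  (mapDomainAlgHom k k (iota d)).range

/-- `f ∈ B_d` iff all exponents of `f` lie in `(1/d)ℤ`. [folklore] -/
theorem mem_levelSubalgebra_iff {d : ℕ} (hd : d ≠ 0) (f : AddMonoidAlgebra k ℚ) :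
    f ∈ levelSubalgebra k d ↔ ∀ q ∈ f.coeff.support, q ∈ (iota d).range := by
  rw [levelSubalgebra, AlgHom.mem_range]
  constructor
  · rintro ⟨g, rfl⟩ q hq
    rw [mapDomainAlgHom_apply] at hq
    classical
    obtain ⟨z, hz, rfl⟩ := Finset.mem_image.mp (Finsupp.mapDomain_support hq)
    exact ⟨z, rfl⟩
  · intro h
    refine ⟨comapDomain (iota d) (iota_injective hd) f, ?_⟩
    rw [mapDomainAlgHom_apply]
    exact mapDomain_comapDomain (fun q hq => h q hq) (iota_injective hd)

/-- **Directedness**: every finite family of elements of `k[ℚ]` lies in a common `B_d`, `d ≠ 0`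
(take `d` the product of all denominators of all exponents). [folklore] -/
theorem exists_forall_mem_levelSubalgebra (C : Finset (AddMonoidAlgebra k ℚ)) :
    ∃ d : ℕ, d ≠ 0 ∧ ∀ f ∈ C, f ∈ levelSubalgebra k d := by
  classical
  refine ⟨∏ f ∈ C, ∏ q ∈ f.coeff.support, q.den, ?_, ?_⟩
  · exact Finset.prod_ne_zero_iff.mpr fun f _ =>
      Finset.prod_ne_zero_iff.mpr fun q _ => q.den_nz
  · intro f hf
    have hd : (∏ f ∈ C, ∏ q ∈ f.coeff.support, q.den) ≠ 0 :=
      Finset.prod_ne_zero_iff.mpr fun f _ => Finset.prod_ne_zero_iff.mpr fun q _ => q.den_nz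
    rw [mem_levelSubalgebra_iff hd]
    intro q hq
    refine mem_range_iota_of_den_dvd hd q ?_
    exact (Finset.dvd_prod_of_mem _ hq).trans (Finset.dvd_prod_of_mem _ hf)

/-! ### The projection onto `B_d` and the functional `ℓ_d` -/

open Classical in
variable (k) in
/-- The **projection `k[ℚ] → B_d`** forgetting the monomials with exponent outside `(1/d)ℤ`, as a
`k`-linear map (it is in fact `B_d`-linear, `proj_mul_of_mem`). [folklore] -/
def proj (d : ℕ) : AddMonoidAlgebra k ℚ →ₗ[k] AddMonoidAlgebra k ℚ where
  toFun f := ofCoeff (f.coeff.filter (· ∈ (iota d).range))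
  map_add' f g := by
    ext q
    simp only [coeff_add, Finsupp.filter_apply, Finsupp.add_apply]
    split_ifs <;> simp
  map_smul' c f := by
    ext q
    simp only [coeff_smul, Finsupp.filter_apply, Finsupp.smul_apply, RingHom.id_apply]
    split_ifs <;> simp

open Classical in
/-- Coefficients of `proj_d f`. [folklore] -/
theorem coeff_proj (d : ℕ) (f : AddMonoidAlgebra k ℚ) (q : ℚ) :
    (proj k d f).coeff q = if q ∈ (iota d).range then f.coeff q else 0 := by
  simp [proj, Finsupp.filter_apply]

/-- `proj_d (f · c t^h) = proj_d(f) · c t^h` for `h ∈ (1/d)ℤ`. [folklore] -/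
theorem proj_mul_single {d : ℕ} (f : AddMonoidAlgebra k ℚ) {h : ℚ} (hh : h ∈ (iota d).range)
    (c : k) : proj k d (f * single h c) = proj k d f * single h c := by
  classical
  ext q
  have key : ∀ g : AddMonoidAlgebra k ℚ, (g * single h c).coeff q = g.coeff (q - h) * c := fun g =>
    coeff_mul_single_eq_coeff_mul (q - h) (fun m _ => by constructor <;> intro e <;> linarith)
  rw [key, coeff_proj, coeff_proj, key]
  have : q ∈ (iota d).range ↔ q - h ∈ (iota d).range := by
    constructor
    · intro hq; exact sub_mem hq hh
    · intro hq; simpa using add_mem hq hh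
  by_cases hq : q ∈ (iota d).range
  · rw [if_pos hq, if_pos (this.mp hq)]
  · rw [if_neg hq, if_neg (fun h' => hq (this.mpr h')), zero_mul]

/-- **`proj_d` is `B_d`-linear**: `proj_d (f b) = proj_d(f) b` for `b ∈ B_d`. [folklore] -/
theorem proj_mul_of_mem {d : ℕ} (f : AddMonoidAlgebra k ℚ) {b : AddMonoidAlgebra k ℚ}
    (hb : b ∈ levelSubalgebra k d) : proj k d (f * b) = proj k d f * b := by
  obtain ⟨g, rfl⟩ := (AlgHom.mem_range _).mp hb
  clear hb
  rw [mapDomainAlgHom_apply]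
  induction g using AddMonoidAlgebra.induction_linear with
  | zero => simp
  | add x y hx hy => rw [mapDomain_add, mul_add, map_add, hx, hy, mul_add]
  | single z c =>
    rw [mapDomain_single]
    exact proj_mul_single f ⟨z, rfl⟩ c

/-- `proj_d` is the identity on `B_d`. [folklore] -/
theorem proj_of_mem {d : ℕ} {b : AddMonoidAlgebra k ℚ} (hb : b ∈ levelSubalgebra k d) :
    proj k d b = b := by
  have := proj_mul_of_mem (1 : AddMonoidAlgebra k ℚ) hb
  rw [one_mul] at this
  rw [this]
  convert one_mul b
  ext q
  rw [coeff_proj, one_def, coeff_single]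
  classical
  rw [Finsupp.single_apply]
  by_cases hq : (0 : ℚ) = q
  · subst hq; simp [zero_mem]
  · rw [if_neg hq]; split_ifs <;> rfl

variable (k) in
/-- The **functional `ℓ_d(f) = proj_d(t^{-1/(2d)} · f)`**: `B_d`-linear (`ell_mul_of_mem`), zero
on `B_d` (`ell_of_mem`), and `ℓ_d(t^{1/(2d)}) = 1` (`ell_single_half`) — it extracts the
coefficient of `k[ℚ] = ⊕_q t^q B_d` along the basis vector `t^{1/(2d)}`. [folklore] -/
def ell (d : ℕ) : AddMonoidAlgebra k ℚ →ₗ[k] AddMonoidAlgebra k ℚ :=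
  (proj k d).comp (LinearMap.mulLeft k (single (-(1 / (2 * d) : ℚ)) (1 : k)))

/-- Unfolding `ℓ_d`. [folklore] -/
theorem ell_apply (d : ℕ) (f : AddMonoidAlgebra k ℚ) :
    ell k d f = proj k d (single (-(1 / (2 * d) : ℚ)) (1 : k) * f) := rfl

/-- `ℓ_d` is `B_d`-linear. [folklore] -/
theorem ell_mul_of_mem {d : ℕ} (f : AddMonoidAlgebra k ℚ) {b : AddMonoidAlgebra k ℚ}
    (hb : b ∈ levelSubalgebra k d) : ell k d (f * b) = ell k d f * b := by
  rw [ell_apply, ell_apply, ← mul_assoc, proj_mul_of_mem _ hb]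

/-- `ℓ_d(1) = 0` (`-1/(2d) ∉ (1/d)ℤ`). [folklore] -/
theorem ell_one {d : ℕ} (hd : d ≠ 0) : ell k d 1 = 0 := by
  rw [ell_apply, mul_one]
  ext q
  rw [coeff_proj, coeff_single]
  classical
  rw [Finsupp.single_apply]
  split_ifs with h1 h2
  · exfalso
    subst h2
    exact half_not_mem_range_iota hd (by simpa using neg_mem h1)
  · rfl
  · rfl

/-- `ℓ_d` vanishes on `B_d`. [folklore] -/
theorem ell_of_mem {d : ℕ} (hd : d ≠ 0) {b : AddMonoidAlgebra k ℚ} (hb : b ∈ levelSubalgebra k d) :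
    ell k d b = 0 := by
  rw [← one_mul b, ell_mul_of_mem 1 hb, ell_one hd, zero_mul]

/-- `ℓ_d(t^{1/(2d)}) = 1`. [folklore] -/
theorem ell_single_half (d : ℕ) : ell k d (single (1 / (2 * d) : ℚ) 1) = 1 := by
  rw [ell_apply, single_mul_single, neg_add_cancel, mul_one, ← one_def]
  exact proj_of_mem (Subalgebra.one_mem _)

/-! ### The obstruction: a finitely presented `k[ℚ]`-algebra of finite type over `k` is zero -/

section obstruction

variable {σ : Type*}

/-- Coefficientwise application of `ℓ_d` to a polynomial over `k[ℚ]`. [folklore] -/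
def coeffwise (d : ℕ) (p : MvPolynomial σ (AddMonoidAlgebra k ℚ)) :
    MvPolynomial σ (AddMonoidAlgebra k ℚ) :=
  AddMonoidAlgebra.map (ell k d).toAddMonoidHom p

/-- Coefficients of `coeffwise d p`. [folklore] -/
@[simp] theorem coeff_coeffwise (d : ℕ) (p : MvPolynomial σ (AddMonoidAlgebra k ℚ)) (m : σ →₀ ℕ) :
    MvPolynomial.coeff m (coeffwise d p) = ell k d (MvPolynomial.coeff m p) := by
  change (AddMonoidAlgebra.map _ p).coeff m = _
  rw [coeff_map]
  rfl

/-- `coeffwise d` is additive. [folklore] -/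
theorem coeffwise_sub (d : ℕ) (p q : MvPolynomial σ (AddMonoidAlgebra k ℚ)) :
    coeffwise d (p - q) = coeffwise d p - coeffwise d q :=
  MvPolynomial.ext _ _ fun m => by simp

/-- `coeffwise d` commutes with finite sums. [folklore] -/
theorem coeffwise_sum {ι : Type*} (d : ℕ) (s : Finset ι)
    (p : ι → MvPolynomial σ (AddMonoidAlgebra k ℚ)) :
    coeffwise d (∑ i ∈ s, p i) = ∑ i ∈ s, coeffwise d (p i) :=
  MvPolynomial.ext _ _ fun m => by simp [MvPolynomial.coeff_sum]

/-- **`B_d`-linearity of `ℓ_d`, coefficientwise**: `Λ(h · s) = Λ(h) · s` for `s` with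
coefficients in `B_d`. [folklore] -/
theorem coeffwise_mul_of_coeffs_mem {d : ℕ} (h s : MvPolynomial σ (AddMonoidAlgebra k ℚ))
    (hs : ∀ m, MvPolynomial.coeff m s ∈ levelSubalgebra k d) :
    coeffwise d (h * s) = coeffwise d h * s := by
  classical
  refine MvPolynomial.ext _ _ fun m => ?_
  simp only [coeff_coeffwise, MvPolynomial.coeff_mul, map_sum]
  exact Finset.sum_congr rfl fun x _ => ell_mul_of_mem _ (hs x.2)

/-- `Λ` kills polynomials with coefficients in `B_d`. [folklore] -/
theorem coeffwise_eq_zero_of_coeffs_mem {d : ℕ} (hd : d ≠ 0)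
    (q : MvPolynomial σ (AddMonoidAlgebra k ℚ))
    (hq : ∀ m, MvPolynomial.coeff m q ∈ levelSubalgebra k d) : coeffwise d q = 0 :=
  MvPolynomial.ext _ _ fun m => by simp [ell_of_mem hd (hq m)]

variable (k σ) in
/-- `Λ(C(t^{1/(2d)})) = 1`. [folklore] -/
theorem coeffwise_C_single_half (d : ℕ) :
    coeffwise d (MvPolynomial.C (single (1 / (2 * d) : ℚ) (1 : k)) :
      MvPolynomial σ (AddMonoidAlgebra k ℚ)) = 1 := by
  classical
  refine MvPolynomial.ext _ _ fun m => ?_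
  simp only [coeff_coeffwise, MvPolynomial.coeff_C, MvPolynomial.coeff_one]
  split_ifs
  · exact ell_single_half d
  · exact map_zero _

variable (k) in
/-- The `k`-subalgebra of polynomials over `k[ℚ]` with all coefficients in `B_d`. [folklore] -/
def coeffsInSubalgebra (σ : Type*) (d : ℕ) : Subalgebra k (MvPolynomial σ (AddMonoidAlgebra k ℚ)) where
  carrier := {p | ∀ m, MvPolynomial.coeff m p ∈ levelSubalgebra k d}
  mul_mem' {p q} hp hq m := by
    classical
    rw [MvPolynomial.coeff_mul]
    exact Subalgebra.sum_mem _ fun x _ => Subalgebra.mul_mem _ (hp x.1) (hq x.2)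
  one_mem' m := by
    classical
    rw [MvPolynomial.coeff_one]
    split_ifs
    · exact Subalgebra.one_mem _
    · exact Subalgebra.zero_mem _
  add_mem' {p q} hp hq m := by
    rw [MvPolynomial.coeff_add]
    exact Subalgebra.add_mem _ (hp m) (hq m)
  zero_mem' m := by simp only [MvPolynomial.coeff_zero]; exact Subalgebra.zero_mem _
  algebraMap_mem' c m := by
    classical
    rw [IsScalarTower.algebraMap_apply k (AddMonoidAlgebra k ℚ) (MvPolynomial σ _),
      MvPolynomial.algebraMap_eq, MvPolynomial.coeff_C]
    split_ifs
    · exact Subalgebra.algebraMap_mem _ c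
    · exact Subalgebra.zero_mem _

/-- If `B_d` contains the coefficients of preimages of a finite generating set of the `k`-algebra
`E` under a `k[ℚ]`-algebra map `f : k[ℚ][X_σ] → E`, then every element of `E` is the image of a
polynomial with coefficients in `B_d`. [folklore] -/
theorem exists_coeffs_mem_of_adjoin_eq_top {E : Type*} [CommRing E] [Algebra (AddMonoidAlgebra k ℚ) E]
    [Algebra k E] [IsScalarTower k (AddMonoidAlgebra k ℚ) E]
    (f : MvPolynomial σ (AddMonoidAlgebra k ℚ) →ₐ[AddMonoidAlgebra k ℚ] E) {d : ℕ}
    (T : Finset E) (hT : Algebra.adjoin k (T : Set E) = ⊤)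
    (hpre : ∀ t ∈ T, ∃ p ∈ coeffsInSubalgebra k σ d, f p = t) (e : E) :
    ∃ p ∈ coeffsInSubalgebra k σ d, f p = e := by
  have : e ∈ ((f.restrictScalars k).comp (coeffsInSubalgebra k σ d).val).range := by
    have hle : Algebra.adjoin k (T : Set E) ≤
        ((f.restrictScalars k).comp (coeffsInSubalgebra k σ d).val).range := by
      rw [Algebra.adjoin_le_iff]
      intro t ht
      obtain ⟨p, hp, hpt⟩ := hpre t ht
      exact ⟨⟨p, hp⟩, hpt⟩
    rw [hT] at hle
    exact hle Algebra.mem_top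
  obtain ⟨⟨p, hp⟩, rfl⟩ := this
  exact ⟨p, hp, rfl⟩

/-- **Tower obstruction.** A finitely presented `k[ℚ]`-algebra `E` which is of finite type over
`k` (for the induced `k`-algebra structure) is the zero ring. See the module docstring for the
proof. (E.g. the fibre `k[ℚ]/(t - 1) ≅ k[ℚ/ℤ]` is finitely presented but not of finite type
over `k`; the fraction field `k(t^q : q ∈ ℚ)` is neither.) [folklore] -/
theorem subsingleton_of_finitePresentation_of_finiteType (E : Type*) [CommRing E]
    [Algebra (AddMonoidAlgebra k ℚ) E] [Algebra k E] [IsScalarTower k (AddMonoidAlgebra k ℚ) E]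
    [Algebra.FinitePresentation (AddMonoidAlgebra k ℚ) E] [Algebra.FiniteType k E] :
    Subsingleton E := by
  classical
  obtain ⟨n, f, hf, hker⟩ := Algebra.FinitePresentation.out (R := AddMonoidAlgebra k ℚ) (A := E)
  obtain ⟨S, hS⟩ := hker
  obtain ⟨T, hT⟩ := Algebra.FiniteType.out (R := k) (A := E)
  choose pre hpre using fun t : E => hf t
  -- all coefficients of the relations and of preimages of the generators lie in one `B_d`
  let C : Finset (AddMonoidAlgebra k ℚ) :=
    (S.biUnion fun s => s.support.image fun m => MvPolynomial.coeff m s) ∪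
      (T.biUnion fun t => (pre t).support.image fun m => MvPolynomial.coeff m (pre t))
  obtain ⟨d, hd, hC⟩ := exists_forall_mem_levelSubalgebra C
  have hcoeff : ∀ p : MvPolynomial (Fin n) (AddMonoidAlgebra k ℚ),
      (∀ m ∈ p.support, MvPolynomial.coeff m p ∈ C) → p ∈ coeffsInSubalgebra k (Fin n) d := by
    intro p hp m
    by_cases hm : m ∈ p.support
    · exact hC _ (hp m hm)
    · rw [MvPolynomial.notMem_support_iff.mp hm]
      exact Subalgebra.zero_mem _
  have hSB : ∀ s ∈ S, s ∈ coeffsInSubalgebra k (Fin n) d := fun s hs =>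
    hcoeff s fun m hm => Finset.mem_union_left _
      (Finset.mem_biUnion.mpr ⟨s, hs, Finset.mem_image.mpr ⟨m, hm, rfl⟩⟩)
  have hTB : ∀ t ∈ T, pre t ∈ coeffsInSubalgebra k (Fin n) d := fun t ht =>
    hcoeff (pre t) fun m hm => Finset.mem_union_right _
      (Finset.mem_biUnion.mpr ⟨t, ht, Finset.mem_image.mpr ⟨m, hm, rfl⟩⟩)
  -- `t^{1/(2d)} · 1_E` is the image of a polynomial `q` with coefficients in `B_d`
  set c₀ : MvPolynomial (Fin n) (AddMonoidAlgebra k ℚ) :=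
    MvPolynomial.C (single (1 / (2 * d) : ℚ) (1 : k)) with hc₀
  obtain ⟨q, hq, hfq⟩ := exists_coeffs_mem_of_adjoin_eq_top f T hT
    (fun t ht => ⟨pre t, hTB t ht, hpre t⟩) (f c₀)
  have hmem : c₀ - q ∈ Ideal.span (S : Set (MvPolynomial (Fin n) (AddMonoidAlgebra k ℚ))) := by
    rw [hS, RingHom.mem_ker]
    change f (c₀ - q) = 0
    rw [map_sub, hfq, sub_self]
  -- `Λ = coeffwise ℓ_d` preserves the ideal of relations
  have hΛ : ∀ x ∈ Ideal.span (S : Set (MvPolynomial (Fin n) (AddMonoidAlgebra k ℚ))),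
      coeffwise d x ∈ Ideal.span (S : Set (MvPolynomial (Fin n) (AddMonoidAlgebra k ℚ))) := by
    intro x hx
    obtain ⟨g, -, rfl⟩ := (Submodule.mem_span_finset).mp hx
    rw [coeffwise_sum]
    refine Submodule.sum_mem _ fun s hs => ?_
    rw [smul_eq_mul, coeffwise_mul_of_coeffs_mem (g s) s (hSB s hs)]
    exact Ideal.mul_mem_left _ _ (Ideal.subset_span hs)
  -- hence `1 = Λ(c₀ - q)` is a relation
  have h1 : (1 : MvPolynomial (Fin n) (AddMonoidAlgebra k ℚ)) ∈ RingHom.ker f.toRingHom := by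
    rw [← hS]
    have := hΛ _ hmem
    rwa [coeffwise_sub, hc₀, coeffwise_C_single_half, coeffwise_eq_zero_of_coeffs_mem hd q hq,
      sub_zero] at this
  rw [RingHom.mem_ker] at h1
  have h1' : (1 : E) = 0 := by
    have : f 1 = 0 := h1
    rwa [map_one] at this
  exact subsingleton_of_zero_eq_one h1'.symm

end obstruction

/-! ### `k[ℚ]` is integrally closed -/

section integrallyClosed

variable (k) in
/-- `k[ℤ]` (the Laurent polynomial ring) is integrally closed: a localization of `k[X]`.
[folklore] -/
theorem isIntegrallyClosed_int : IsIntegrallyClosed (AddMonoidAlgebra k ℤ) := by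
  change IsIntegrallyClosed (LaurentPolynomial k)
  haveI := LaurentPolynomial.isLocalization (R := k)
  exact isIntegrallyClosed_of_isLocalization (R := Polynomial k) (LaurentPolynomial k)
    (Submonoid.powers (Polynomial.X : Polynomial k))
    (powers_le_nonZeroDivisors_of_noZeroDivisors Polynomial.X_ne_zero)

/-- `k[ℤ] ≅ B_d` for `d ≠ 0` (via `ι_d`). [folklore] -/
def levelEquiv {d : ℕ} (hd : d ≠ 0) : AddMonoidAlgebra k ℤ ≃ₐ[k] levelSubalgebra k d :=
  AlgEquiv.ofInjective (mapDomainAlgHom k k (iota d)) (by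
    intro x y h
    rw [mapDomainAlgHom_apply, mapDomainAlgHom_apply] at h
    exact mapDomain_injective (iota_injective hd) h)

/-- Each level subalgebra `B_d`, `d ≠ 0`, is integrally closed. [folklore] -/
theorem isIntegrallyClosed_levelSubalgebra {d : ℕ} (hd : d ≠ 0) :
    IsIntegrallyClosed (levelSubalgebra k d) :=
  haveI := isIntegrallyClosed_int k
  IsIntegrallyClosed.of_equiv (levelEquiv hd).toRingEquiv

variable (k) in
/-- **`k[ℚ]` is integrally closed** (a directed union of copies of the Laurent polynomial ring;
see the module docstring). [folklore] -/
theorem isIntegrallyClosed_rat : IsIntegrallyClosed (AddMonoidAlgebra k ℚ) := by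
  classical
  set G := AddMonoidAlgebra k ℚ
  let K := FractionRing G
  refine (isIntegrallyClosed_iff K).mpr fun {x} hx => ?_
  obtain ⟨p, hpm, hpx⟩ := hx
  obtain ⟨a, b, hb, hab⟩ := IsFractionRing.div_surjective (A := G) x
  -- a common level `d` for `a`, `b` and the coefficients of `p`
  obtain ⟨d, hd, hC⟩ := exists_forall_mem_levelSubalgebra
    (insert a (insert b (p.support.image fun i => p.coeff i)))
  have ha : a ∈ levelSubalgebra k d := hC a (Finset.mem_insert_self _ _)
  have hbB : b ∈ levelSubalgebra k d := hC b (Finset.mem_insert_of_mem (Finset.mem_insert_self _ _))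
  have hp : ∀ i, p.coeff i ∈ levelSubalgebra k d := by
    intro i
    by_cases hi : i ∈ p.support
    · exact hC _ (Finset.mem_insert_of_mem (Finset.mem_insert_of_mem
        (Finset.mem_image.mpr ⟨i, hi, rfl⟩)))
    · rw [Polynomial.notMem_support_iff.mp hi]; exact Subalgebra.zero_mem _
  set B := levelSubalgebra k d
  haveI : IsIntegrallyClosed B := isIntegrallyClosed_levelSubalgebra hd
  -- `B → K` is injective; extend to `Frac B → K`
  have hinj : Function.Injective (algebraMap B K) := by
    rw [IsScalarTower.algebraMap_eq B G K]
    exact (IsFractionRing.injective G K).comp Subtype.val_injective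
  let L := FractionRing B
  let j : L →ₐ[B] K :=
    { IsFractionRing.lift hinj with commutes' := fun c => IsFractionRing.lift_algebraMap hinj c }
  have hj : Function.Injective j := fun x y h => (IsFractionRing.lift hinj).injective h
  -- `x` is integral over `B`
  have hxB : IsIntegral B x := by
    have hlifts : p ∈ Polynomial.lifts (algebraMap B G) := by
      rw [Polynomial.lifts_iff_coeff_lifts]
      intro i
      exact ⟨⟨p.coeff i, hp i⟩, rfl⟩
    obtain ⟨q, hq, -, hqm⟩ := Polynomial.lifts_and_degree_eq_and_monic hlifts hpm
    refine ⟨q, hqm, ?_⟩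
    rw [IsScalarTower.algebraMap_eq B G K, ← Polynomial.eval₂_map, hq]
    exact hpx
  -- `x = j (a / b)` with `a / b ∈ Frac B` integral over `B`, hence in `B`
  set y : L := algebraMap B L ⟨a, ha⟩ / algebraMap B L ⟨b, hbB⟩ with hy
  have hjy : j y = x := by
    rw [hy, map_div₀]
    change IsFractionRing.lift hinj _ / IsFractionRing.lift hinj _ = x
    rw [IsFractionRing.lift_algebraMap, IsFractionRing.lift_algebraMap]
    exact hab
  have hyB : IsIntegral B y := by
    rw [← isIntegral_algHom_iff j hj, hjy]
    exact hxB
  obtain ⟨c, hc⟩ := (IsIntegrallyClosed.isIntegral_iff (R := B) (K := L)).mp hyB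
  refine ⟨(c : G), ?_⟩
  rw [← hjy, ← hc]
  change _ = IsFractionRing.lift hinj _
  rw [IsFractionRing.lift_algebraMap]
  rfl

end integrallyClosed

end RatGroupAlgebra

end Literature.AlgebraicGeometry.Resolution
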